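import Literature.Probability.RandomPlanarGeometry.SAWWordBridges
import Literature.Probability.RandomPlanarGeometry.SAWLowerBound
import Mathlib
import HarnessLib

/-!
# Stub `kestenSpanOne_law` of crux `ConfinementPositivity` (stmt-CriticalPhenomena-17587),
# line `Sketch` (sign-universality): the exact span-1 law of Kesten's measure

Kesten's measure on irreducible bridges charges the word `w` with `x_c ^ |w|`.  This file computes
its restriction to span `1` exactly: for every height increment `h : ℤ`,

`kestenSpanOne_law : ∑' w : {w // IsIrrBridge w}, (if xEnd w = 1 ∧ wEnd w 1 = h then x_c ^ |w| else 0)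
    = x_c ^ (|h| + 1)`,

i.e. given span `1` the height increment is two-sided geometric and **every residue is charged**
(the arithmetic, non-lattice input of the pinning layer B′p of the line).

## Proof

* **Classification** (`spanOne_eq_vertWord`).  A self-avoiding bridge `w` of span `1` is a
  vertical stick `vertWord d m = [+e₀] ++ m·[d]` with `d ∈ {+e₁, -e₁}` (`d = 1` or `d = 3`):
  the bridge condition `0 < x(i) ≤ x(|w|) = 1` forces `x(i) = 1` for `1 ≤ i ≤ |w|`
  (`spanOne_xAt_eq_one`), so the first letter has `dx = 1`, i.e. is `0` (`spanOne_getElem_zero`),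
  and every later letter has `dx = 0`, i.e. is `1` or `3` (`spanOne_getElem_succ`); an immediate
  reversal `1, 3` or `3, 1` would bring the walk back to the vertex visited two steps earlier,
  contradicting self-avoidance (`spanOne_no_reversal`), so all later letters are equal
  (`spanOne_getElem_eq`).  Irreducibility is not used.
* **Sticks** (`Literature…SAWLowerBound`: `isIrrBridge_vertWord`, `traj_vertWord`).  Conversely
  `vertWord d m` (`d` vertical) is an irreducible bridge of span `1`, of length `m + 1` and height
  `wEnd (vertWord d m) 1 = m · dy d` (`spanOne_wEnd_vertWord`); two sticks with the same height are
  equal (`spanOne_vertWord_unique`; for `m = 0` both orientations give `[+e₀]`).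
* **The sum.**  Hence the summand is supported on the single stick of height `h`, namely
  `vertWord (if 0 ≤ h then 1 else 3) |h|`, and `tsum_eq_single` evaluates the `tsum` to
  `x_c ^ (|h| + 1)`.

All sums are in `ℝ≥0∞`; no summability and no positivity of `x_c` is needed.  No `def`s.
-/

noncomputable section
open scoped BigOperators ENNReal
open Classical
open Literature.Probability.RandomPlanarGeometry Literature.Probability.RandomPlanarGeometry.SAW
open Literature.Probability.LatticeModels

namespace Summit.CriticalPhenomena.SAWScalingLimit.Theorems

/-! ### Classification of the span-1 bridges -/

/-- Along a bridge of span `1`, the first coordinate equals `1` at all times `1 ≤ i ≤ |w|`. -/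
theorem spanOne_xAt_eq_one {w : List Step} (hb : IsBridgeW w) (hx : xEnd w = 1) {i : ℕ}
    (h1 : 1 ≤ i) (h2 : i ≤ w.length) : xAt w i = 1 := by
  obtain ⟨a, b⟩ := (isBridgeW_iff w).1 hb i h1 h2
  rw [hx] at b
  omega

/-- The first letter of a non-empty bridge of span `1` is `0` (the step `+e₀`). -/
theorem spanOne_getElem_zero {w : List Step} (hb : IsBridgeW w) (hx : xEnd w = 1)
    (h0 : 0 < w.length) : w[0] = 0 := by
  have h := xAt_succ w h0
  rw [spanOne_xAt_eq_one hb hx le_rfl h0, xAt_zero] at h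
  have key : ∀ d : Step, (1 : ℤ) = 0 + Step.dx d → d = 0 := by decide
  exact key _ h

/-- Every later letter of a bridge of span `1` is vertical: `1` (`+e₁`) or `3` (`-e₁`). -/
theorem spanOne_getElem_succ {w : List Step} (hb : IsBridgeW w) (hx : xEnd w = 1) {i : ℕ}
    (hi : i + 1 < w.length) : w[i + 1] = 1 ∨ w[i + 1] = 3 := by
  have h := xAt_succ w hi
  rw [spanOne_xAt_eq_one hb hx (by omega) hi, spanOne_xAt_eq_one hb hx (by omega) hi.le] at h
  have key : ∀ d : Step, (1 : ℤ) = 1 + Step.dx d → d = 1 ∨ d = 3 := by decide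
  exact key _ h

/-- Self-avoidance forbids an immediate reversal (two consecutive steps summing to `0`): the walk
would be back at `traj w i` at time `i + 2`. -/
theorem spanOne_no_reversal {w : List Step} (hs : IsSAW w) {i : ℕ} (hi : i + 1 < w.length)
    (hrev : Step.vec (w[i]'(by omega)) + Step.vec (w[i + 1]) = 0) : False := by
  have h1 := traj_succ w (show i < w.length by omega)
  have h2 := traj_succ w hi
  have h3 : traj w (i + 1 + 1) = traj w i := by
    rw [h2, h1, add_assoc, hrev, add_zero]
  have := (isSAW_iff_injOn w).1 hs (show i + 1 + 1 ≤ w.length by omega)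
    (show i ≤ w.length by omega) h3
  omega

/-- All letters after the first of a self-avoiding bridge of span `1` are equal. -/
theorem spanOne_getElem_eq {w : List Step} (hs : IsSAW w) (hb : IsBridgeW w) (hx : xEnd w = 1)
    {i : ℕ} (hi : i + 1 < w.length) : w[i + 1] = w[0 + 1]'(by omega) := by
  induction i with
  | zero => rfl
  | succ i ih =>
    have hprev := ih (by omega)
    suffices h : w[i + 1 + 1] = w[i + 1]'(by omega) from h.trans hprev
    have h1 := spanOne_getElem_succ hb hx (show i + 1 < w.length by omega)
    have h2 := spanOne_getElem_succ hb hx hi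
    by_contra hne
    apply spanOne_no_reversal hs hi
    have key : ∀ d d' : Step, (d = 1 ∨ d = 3) → (d' = 1 ∨ d' = 3) → d' ≠ d →
        Step.vec d + Step.vec d' = 0 := by decide
    exact key _ _ h1 h2 hne

/-- **Classification of the span-1 bridges.**  A self-avoiding bridge of span `1` is a vertical
stick `vertWord d m = [+e₀] ++ m·[d]` with `d = 1` (`+e₁`) or `d = 3` (`-e₁`). -/
theorem spanOne_eq_vertWord {w : List Step} (hs : IsSAW w) (hb : IsBridgeW w) (hx : xEnd w = 1) :
    ∃ (d : Step) (m : ℕ), (d = 1 ∨ d = 3) ∧ w = vertWord d m := by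
  cases w with
  | nil => simp [xEnd] at hx
  | cons a t =>
    have ha : (a :: t)[0] = 0 := spanOne_getElem_zero hb hx (by simp)
    change a = 0 at ha
    subst ha
    rcases Nat.eq_zero_or_pos t.length with ht | ht
    · exact ⟨1, 0, Or.inl rfl, by rw [List.length_eq_zero_iff.1 ht]; rfl⟩
    · have hall : ∀ b ∈ t, b = t[0] := by
        intro b hb'
        obtain ⟨j, hj, rfl⟩ := List.mem_iff_getElem.1 hb'
        have := spanOne_getElem_eq hs hb hx (i := j) (by simp only [List.length_cons]; omega)
        simpa using this
      have h13 : t[0] = 1 ∨ t[0] = 3 := by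
        have := spanOne_getElem_succ hb hx (i := 0) (by simp only [List.length_cons]; omega)
        simpa using this
      refine ⟨t[0], t.length, h13, ?_⟩
      rw [vertWord, ← List.eq_replicate_of_mem hall]

/-! ### The sticks -/

/-- The height of a stick: `wEnd (vertWord d m) 1 = m · dy d` for vertical `d`. -/
theorem spanOne_wEnd_vertWord {d : Step} (hd : Step.dx d = 0) (m : ℕ) :
    wEnd (vertWord d m) 1 = m * Step.dy d := by
  have h := (traj_vertWord hd m m le_rfl).2
  have hl := traj_length (vertWord d m)
  rw [length_vertWord] at hl
  rwa [hl] at h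

/-- Two sticks with the same height are equal (for `m = 0` both orientations give `[+e₀]`). -/
theorem spanOne_vertWord_unique {d d' : Step} (hd : d = 1 ∨ d = 3) (hd' : d' = 1 ∨ d' = 3)
    {m m' : ℕ} (h : (m : ℤ) * Step.dy d = (m' : ℤ) * Step.dy d') :
    vertWord d m = vertWord d' m' := by
  rcases hd with rfl | rfl <;> rcases hd' with rfl | rfl
  · rw [show Step.dy 1 = 1 from rfl, mul_one, mul_one] at h
    rw [show m = m' by exact_mod_cast h]
  · rw [show Step.dy 1 = 1 from rfl, show Step.dy 3 = -1 from rfl, mul_one, mul_neg_one] at h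
    rw [show m = 0 by omega, show m' = 0 by omega]
    rfl
  · rw [show Step.dy 1 = 1 from rfl, show Step.dy 3 = -1 from rfl, mul_one, mul_neg_one] at h
    rw [show m = 0 by omega, show m' = 0 by omega]
    rfl
  · rw [show Step.dy 3 = -1 from rfl, mul_neg_one, mul_neg_one] at h
    rw [show m = m' by omega]

/-! ### The span-1 law -/

/-- **The exact span-1 law of Kesten's measure.**  For every `h : ℤ`, the critical mass
`∑ x_c ^ |w|` of the irreducible bridges `w` of span `xEnd w = 1` and height increment
`wEnd w 1 = h` is exactly `x_c ^ (|h| + 1)`: the only such bridge is the stick `[+e₀] ++ |h|·[±e₁]`. -/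
theorem kestenSpanOne_law : ∀ h : ℤ,
    (∑' w : {w : List Step // IsIrrBridge w},
        if (xEnd w.1 = 1 ∧ wEnd w.1 1 = h) then ENNReal.ofReal (criticalFugacity ^ w.1.length) else 0) =
      ENNReal.ofReal (criticalFugacity ^ (h.natAbs + 1)) := by
  intro h
  -- the stick of height `h`: orientation `d`, `|h|` vertical steps
  obtain ⟨d, hd, hdx, hdy, hdyh⟩ : ∃ d : Step, (d = 1 ∨ d = 3) ∧ Step.dx d = 0 ∧ Step.dy d ≠ 0 ∧
      (h.natAbs : ℤ) * Step.dy d = h := by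
    rcases le_or_gt 0 h with hh | hh
    · exact ⟨1, Or.inl rfl, rfl, by decide,
        by rw [show Step.dy 1 = 1 from rfl, mul_one]; exact Int.natAbs_of_nonneg hh⟩
    · exact ⟨3, Or.inr rfl, rfl, by decide,
        by rw [show Step.dy 3 = -1 from rfl, mul_neg_one]; omega⟩
  obtain ⟨hirr, hx1⟩ := isIrrBridge_vertWord hdx hdy h.natAbs
  have hend : wEnd (vertWord d h.natAbs) 1 = h := by rw [spanOne_wEnd_vertWord hdx, hdyh]
  rw [tsum_eq_single (⟨vertWord d h.natAbs, hirr⟩ : {w : List Step // IsIrrBridge w})]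
  · rw [if_pos ⟨hx1, hend⟩, length_vertWord]
  · rintro ⟨w, hw⟩ hne
    dsimp only
    refine if_neg ?_
    rintro ⟨hwx, hwh⟩
    apply hne
    obtain ⟨d', m, hd', rfl⟩ := spanOne_eq_vertWord hw.saw hw.bridge hwx
    have hdx' : Step.dx d' = 0 := by rcases hd' with rfl | rfl <;> rfl
    apply Subtype.ext
    show vertWord d' m = vertWord d h.natAbs
    apply spanOne_vertWord_unique hd' hd
    rw [← spanOne_wEnd_vertWord hdx' m, hdyh]
    exact hwh

end Summit.CriticalPhenomena.SAWScalingLimit.Theorems
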